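import Literature.Computability.Complexity.GateEliminationTransfer
import Literature.Computability.Complexity.GateEliminationXorMap
import Literature.Computability.Complexity.GateEliminationOutput

/-!
# Gate elimination, X: rewiring a semantically constant wire of a gate of the acyclic part

Sixth layer of the toolkit for the one-step claim `LiYang2022_step` (Li–Yang, STOC 2022; full
version ECCC TR21-023, §4.1 Case 0.3: "if there is a gate `G` fed by `I₁` and `I₂` that computes
a function that only depends on `I₁`, we rewire the circuit such that `G` is fed by `I₁` and a
constant (this operation increases the potential by at most one, like the normalization rules) …
so that `G` can be removed by Rule 3"). Everything is PROVED.

* `Semicircuit.rewireConst k₀ a₀ c` — the wire at position `a₀` of gate `k₀` replaced by the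
  constant `c`. For a gate **outside the xor-part** this keeps fairness whatever `c` is
  (`Fair.rewireConst`: the xor-part is untouched and the acyclic part evaluates —
  `fair_of_xorPart`, `Fair.xor_unique` of the affine layers); if moreover the old wire has the
  value `c` on every solution, the solutions are unchanged (`consistent_rewireConst_iff`) and
  `f|_R` is still computed (`ComputesRestr.rewireConst`). (Inside the cyclic xor-part such a
  rewiring can destroy fairness, which is why the operation is restricted.)
* Accounting: the rewired node loses one wire (`fanout_rewireConst_add`), new troubled gates
  are caused by it (`causedBy_of_new_troubled_rewireConst`), `Φ' ≤ Φ + 1`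
  (`exists_packing_rewireConst`, through `exists_packing_transfer`), influential inputs do not
  appear.
* **`eliminate_semantic_const_wire`**: under the hypotheses of the one-step claim, a gate of
  the acyclic part one of whose wires carries a constant value on all solutions is eliminated:
  one gate fewer, `μ' ≤ μ - (1 - 2α_φ)` (rewire, then `rule23_any`).
  This is how a topologically minimal ∧-gate with a constant input gate is disposed of without
  touching the xor-part.

## References

* J. Li, T. Yang, *3.1n − o(n) circuit lower bounds for explicit functions*, STOC 2022
  [LiYang2022]; full version ECCC TR21-023, §4.1 (Case 0.3), §3.3, Lemma 3.11.
-/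

namespace Literature.Computability.Complexity

open Finset

namespace Semicircuit

variable {n : ℕ} (C : Semicircuit n)

/-- **Rewiring one wire of a gate of the acyclic part to a constant** (Li–Yang §4.1, Case 0.3:
"if there is a gate `G` fed by `I₁` and `I₂` that computes a function that only depends on `I₁`,
we rewire the circuit such that `G` is fed by `I₁` and a constant"; here in the form: a wire whose
value is constant is replaced by that constant). Only for gates outside the xor-part, where it
is harmless for fairness. [cite: LiYang2022, §4.1 (Case 0.3)] -/
abbrev rewireConst (k₀ : Fin C.m) (a₀ : Fin 2) (c : Bool) : Semicircuit n where
  m := C.m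
  op := C.op
  arg k a := if k = k₀ ∧ a = a₀ then .const c else C.arg k a
  out := C.out
  xorPart := C.xorPart
  isXorOp_of_mem := C.isXorOp_of_mem
  mem_of_arg_eq k hk a k' h := by
    by_cases hka : k = k₀ ∧ a = a₀
    · rw [if_pos hka] at h; cases h
    · rw [if_neg hka] at h; exact C.mem_of_arg_eq k hk a k' h
  acyclic := by
    obtain ⟨ρ, hρ⟩ := C.acyclic
    refine ⟨ρ, fun k hk a k' h hk' => ?_⟩
    by_cases hka : k = k₀ ∧ a = a₀
    · rw [if_pos hka] at h; cases h
    · rw [if_neg hka] at h; exact hρ k hk a k' h hk'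

section RewireConst

variable (k₀ : Fin C.m) (a₀ : Fin 2) (c : Bool)

/-- Wires after rewiring. [folklore] -/
theorem rewireConst_arg (k : Fin C.m) (a : Fin 2) :
    (C.rewireConst k₀ a₀ c).arg k a = if k = k₀ ∧ a = a₀ then .const c else C.arg k a := rfl

/-- Node values are computed by the same function. [folklore] -/
theorem nodeVal_rewireConst_eq (x : Fin n → Bool) (w : Fin C.m → Bool) (u : Node n C.m) :
    (C.rewireConst k₀ a₀ c).nodeVal x w u = C.nodeVal x w u := by
  cases u <;> rfl

/-- The xor-part equations are unchanged by rewiring a gate of the acyclic part. [folklore] -/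
theorem xorConsistent_rewireConst_iff (hk₀ : k₀ ∉ C.xorPart) (x : Fin n → Bool) (w : Fin C.m → Bool) :
    (C.rewireConst k₀ a₀ c).XorConsistent x w ↔ C.XorConsistent x w := by
  unfold XorConsistent GateEq
  refine forall₂_congr fun j hj => ?_
  have hj0 : ¬ (j = k₀ ∧ (0 : Fin 2) = a₀) := fun h => hk₀ (h.1 ▸ hj)
  have hj1 : ¬ (j = k₀ ∧ (1 : Fin 2) = a₀) := fun h => hk₀ (h.1 ▸ hj)
  simp only [nodeVal_rewireConst_eq, hj0, hj1, if_false]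

variable {C k₀ a₀ c} in
/-- **A solution of `C` on which the rewired wire has the value `c` solves the rewired circuit.**
[folklore] -/
theorem Consistent.rewireConst {x : Fin n → Bool} {w : Fin C.m → Bool} (hw : C.Consistent x w)
    (hc : C.nodeVal x w (C.arg k₀ a₀) = c) : (C.rewireConst k₀ a₀ c).Consistent x w := by
  intro k
  show w k = C.op k _ _
  rw [nodeVal_rewireConst_eq, nodeVal_rewireConst_eq, rewireConst_arg, rewireConst_arg]
  have key : ∀ a, C.nodeVal x w (if k = k₀ ∧ a = a₀ then .const c else C.arg k a) = C.nodeVal x w (C.arg k a) := by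
    intro a
    split_ifs with h
    · rw [h.1, h.2]; exact hc.symm
    · rfl
  rw [key 0, key 1]
  exact hw k

variable {C k₀ a₀} in
/-- **Rewiring a wire of a gate of the acyclic part to a constant preserves fairness**
(whatever the constant: the xor-part is unchanged, and the acyclic part evaluates). [folklore] -/
theorem Fair.rewireConst (hF : C.Fair) (hk₀ : k₀ ∉ C.xorPart) (c : Bool) : (C.rewireConst k₀ a₀ c).Fair := by
  refine fair_of_xorPart (fun x => ?_) fun x w w' hw hw' => ?_
  · obtain ⟨w, hw, -⟩ := hF x
    exact ⟨w, ((C.xorConsistent_rewireConst_iff k₀ a₀ c hk₀ x w).mpr (consistent_iff_xor_acyclic.mp hw).1)⟩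
  · rw [C.xorConsistent_rewireConst_iff k₀ a₀ c hk₀] at hw hw'
    exact hF.xor_unique hw hw'

variable {C k₀ a₀ c} in
/-- Under fairness, the solutions of the rewired circuit are exactly those of `C`, provided the
rewired wire has the value `c` on every solution of `C`. [folklore] -/
theorem consistent_rewireConst_iff (hF : C.Fair) (hk₀ : k₀ ∉ C.xorPart)
    (hc : ∀ (x : Fin n → Bool) (w : Fin C.m → Bool), C.Consistent x w → C.nodeVal x w (C.arg k₀ a₀) = c)
    (x : Fin n → Bool) (w : Fin C.m → Bool) :
    (C.rewireConst k₀ a₀ c).Consistent x w ↔ C.Consistent x w := by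
  constructor
  · intro hw
    obtain ⟨w₀, hw₀, -⟩ := hF x
    have hw₀' : (C.rewireConst k₀ a₀ c).Consistent x w₀ := hw₀.rewireConst (hc x w₀ hw₀)
    obtain ⟨w₁, -, huniq⟩ := hF.rewireConst (a₀ := a₀) hk₀ c x
    rw [huniq w hw, ← huniq w₀ hw₀']
    exact hw₀
  · intro hw
    exact hw.rewireConst (hc x w hw)

variable {C k₀ a₀ c} in
/-- **Rewiring keeps computing `f|_R`.** [cite: LiYang2022, §4.1 (Case 0.3)] -/
theorem ComputesRestr.rewireConst {f : (Fin n → ZMod 2) → Bool} {R : RdqSource n}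
    (hC : C.ComputesRestr f R) (hF : C.Fair) (hk₀ : k₀ ∉ C.xorPart)
    (hc : ∀ (x : Fin n → Bool) (w : Fin C.m → Bool), C.Consistent x w → C.nodeVal x w (C.arg k₀ a₀) = c) :
    (C.rewireConst k₀ a₀ c).ComputesRestr f R := by
  refine ⟨fun i hi => ?_, fun u hu w hw => ?_⟩
  · -- out-degrees of variables do not grow
    have h0 := hC.1 i hi
    unfold fanout at h0 ⊢
    rw [Finset.sum_eq_zero_iff] at h0 ⊢
    intro k hk
    have := h0 k hk
    rw [card_eq_zero, filter_eq_empty_iff] at this ⊢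
    intro a ha h
    rw [rewireConst_arg] at h
    split_ifs at h with hka
    · exact this ha h
  · rw [consistent_rewireConst_iff hF hk₀ hc] at hw
    rw [nodeVal_rewireConst_eq]
    exact hC.2 u hu w hw

/-- Out-degree after rewiring: the rewired node loses one wire, others are unchanged. [folklore] -/
theorem fanout_rewireConst_add (u : Node n C.m) (hu : ∀ b, u ≠ .const b) :
    (C.rewireConst k₀ a₀ c).fanout u + (if C.arg k₀ a₀ = u then 1 else 0) = C.fanout u := by
  unfold fanout
  have key : ∀ k, (univ.filter fun a : Fin 2 => (C.rewireConst k₀ a₀ c).arg k a = u).card +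
      (if k = k₀ then (if C.arg k₀ a₀ = u then 1 else 0) else 0) =
      (univ.filter fun a : Fin 2 => C.arg k a = u).card := by
    intro k
    by_cases hk : k = k₀
    · rw [hk, if_pos rfl]
      have hc : ¬ (Node.const c = u) := fun h => hu c h.symm
      have hfilt : (univ.filter fun a : Fin 2 => (C.rewireConst k₀ a₀ c).arg k₀ a = u) =
          (univ.filter fun a : Fin 2 => C.arg k₀ a = u).erase a₀ := by
        ext a
        simp only [mem_filter, mem_univ, true_and, mem_erase]
        by_cases ha : a = a₀
        · subst ha; simp [hc]
        · simp [ha]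
      rw [hfilt]
      by_cases hmem : a₀ ∈ univ.filter fun a : Fin 2 => C.arg k₀ a = u
      · rw [card_erase_of_mem hmem, if_pos (mem_filter.mp hmem).2]
        have := card_pos.mpr ⟨a₀, hmem⟩
        omega
      · rw [erase_eq_of_notMem hmem, if_neg (fun h => hmem (mem_filter.mpr ⟨mem_univ _, h⟩)), add_zero]
    · rw [if_neg hk, add_zero]
      congr 1; ext a
      simp only [mem_filter, mem_univ, true_and, hk, false_and, if_false]
  calc (∑ k, (univ.filter fun a : Fin 2 => (C.rewireConst k₀ a₀ c).arg k a = u).card) +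
        (if C.arg k₀ a₀ = u then 1 else 0)
      = (∑ k, (univ.filter fun a : Fin 2 => (C.rewireConst k₀ a₀ c).arg k a = u).card) +
        ∑ k : Fin C.m, (if k = k₀ then (if C.arg k₀ a₀ = u then 1 else 0) else 0) := by
          rw [Finset.sum_ite_eq' univ k₀, if_pos (mem_univ _)]
    _ = ∑ k, ((univ.filter fun a : Fin 2 => (C.rewireConst k₀ a₀ c).arg k a = u).card +
        (if k = k₀ then (if C.arg k₀ a₀ = u then 1 else 0) else 0)) := (sum_add_distrib).symm
    _ = ∑ k, (univ.filter fun a : Fin 2 => C.arg k a = u).card := sum_congr rfl fun k _ => key k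

end RewireConst


/-! ### Accounting and packaging for `rewireConst` -/

section RewireConstRule

variable (k₀ : Fin C.m) (a₀ : Fin 2) (c : Bool)

/-- After rewiring, `k₀` is fed by a constant, hence not troubled. [folklore] -/
theorem not_troubled_rewireConst_self : ¬ (C.rewireConst k₀ a₀ c).Troubled k₀ :=
  not_troubled_of_reads_const (a := a₀) (b := c) (by rw [rewireConst_arg, if_pos ⟨rfl, rfl⟩])

/-- Gates other than `k₀` keep their wires. [folklore] -/
theorem rewireConst_arg_of_ne {k : Fin C.m} (hk : k ≠ k₀) (a : Fin 2) :
    (C.rewireConst k₀ a₀ c).arg k a = C.arg k a := by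
  rw [rewireConst_arg, if_neg (fun h => hk h.1)]

/-- **New troubled gates after rewiring are caused by the rewired node.** [cite: LiYang2022, §4.1 (Case 0.3)] -/
theorem causedBy_of_new_troubled_rewireConst {k : Fin C.m} (hT' : (C.rewireConst k₀ a₀ c).Troubled k)
    (hT : ¬ C.Troubled k) : CausedBy C (C.rewireConst k₀ a₀ c) id (C.arg k₀ a₀) k := by
  by_contra hcon
  unfold CausedBy at hcon
  push Not at hcon
  have hk : k ≠ k₀ := fun h => by rw [h] at hT'; exact C.not_troubled_rewireConst_self k₀ a₀ c hT'
  have hargs : (C.rewireConst k₀ a₀ c).arg k = C.arg k := funext fun a => C.rewireConst_arg_of_ne k₀ a₀ c hk a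
  obtain ⟨hand, h1, x, y, hxy, hr, hx, hy⟩ := hT'
  rw [hargs] at hr
  have hxr : ∃ a', C.arg k a' = .var x := by
    have : (Node.var x : Node n C.m) ∈ Set.range (C.arg k) := by rw [hr]; simp
    exact this
  have hyr : ∃ a', C.arg k a' = .var y := by
    have : (Node.var y : Node n C.m) ∈ Set.range (C.arg k) := by rw [hr]; simp
    exact this
  have hfan : ∀ (u : Node n C.m), (∀ b, u ≠ .const b) → C.arg k₀ a₀ ≠ u →
      (C.rewireConst k₀ a₀ c).fanout u = C.fanout u := by
    intro u hu hne
    have := C.fanout_rewireConst_add k₀ a₀ c u hu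
    rw [if_neg hne, add_zero] at this
    exact this
  apply hT
  refine ⟨hand, ?_, x, y, hxy, hr, ?_, ?_⟩
  · rw [← hfan (.gate k) (fun b h => by cases h) (fun h => hcon.1 h)]; exact h1
  · rw [← hfan (.var x) (fun b h => by cases h) (fun h => hcon.2 x h _ (by rw [hargs]; exact hxr.choose_spec))]
    exact hx
  · rw [← hfan (.var y) (fun b h => by cases h) (fun h => hcon.2 y h _ (by rw [hargs]; exact hyr.choose_spec))]
    exact hy

/-- **Rewiring accounting**: `Φ' ≤ Φ + 1` ("this operation increases the potential by at most
one, like the normalization rules", Li–Yang Case 0.3). [cite: LiYang2022, §4.1 (Case 0.3)] -/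
theorem exists_packing_rewireConst {P : Finset (Fin C.m × Fin C.m)} (hP : C.IsPacking P) :
    ∃ P' : Finset (Fin C.m × Fin C.m), (C.rewireConst k₀ a₀ c).IsPacking P' ∧
      (C.rewireConst k₀ a₀ c).potential P' ≤ C.potential P + 1 := by
  classical
  set C' := C.rewireConst k₀ a₀ c
  set A : Finset (Fin C.m) := univ.filter fun k => C'.Troubled k ∧ CausedBy C C' id (C.arg k₀ a₀) k with hA
  have hAgood : C'.GoodCover A := goodCover_causedBy C C' id (fun _ _ h => h) _ A fun k hk => (mem_filter.mp hk).2
  have hcover : ∀ k, C'.Troubled k → ¬ C.Troubled (id k) → k ∈ A ∨ k ∈ (∅ : Finset (Fin C.m)) :=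
    fun k hk hkT => Or.inl (mem_filter.mpr ⟨mem_univ _, hk, C.causedBy_of_new_troubled_rewireConst k₀ a₀ c hk hkT⟩)
  have hadj : ∀ k k', C'.Troubled k → C'.Troubled k' → C.Troubled (id k) → C.Troubled (id k') →
      C.Adjacent (id k) (id k') → C'.Adjacent k k' := by
    intro k k' hk hk' _ _ ⟨z, hz, hz'⟩
    have hk0 : k ≠ k₀ := fun h => by rw [h] at hk; exact C.not_troubled_rewireConst_self k₀ a₀ c hk
    have hk0' : k' ≠ k₀ := fun h => by rw [h] at hk'; exact C.not_troubled_rewireConst_self k₀ a₀ c hk'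
    refine ⟨z, ?_, ?_⟩
    · obtain ⟨a, ha⟩ := hz; exact ⟨a, by rw [C.rewireConst_arg_of_ne k₀ a₀ c hk0]; exact ha⟩
    · obtain ⟨a, ha⟩ := hz'; exact ⟨a, by rw [C.rewireConst_arg_of_ne k₀ a₀ c hk0']; exact ha⟩
  obtain ⟨P', hP', hpot⟩ := exists_packing_transfer C C' id (fun _ _ h => h) hP
    (fun p _ => ⟨⟨p.1, rfl⟩, ⟨p.2, rfl⟩⟩) hadj A ∅ hcover hAgood (Or.inl (by simp))
  refine ⟨P', hP', hpot.trans ?_⟩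
  have h1 : ((if A = ∅ then 0 else 1 : ℕ) : ℝ) ≤ 1 := by exact_mod_cast ite_empty_le_one A
  have h2 : ((if (∅ : Finset (Fin C.m)) = ∅ then 0 else 1 : ℕ) : ℝ) = 0 := by simp
  linarith

/-- Influential inputs do not appear when rewiring (out-degrees do not grow; protected set is
unchanged). [cite: LiYang2022, Def. 3.6] -/
theorem influential_rewireConst_subset (R : RdqSource n) :
    (C.rewireConst k₀ a₀ c).influential R ⊆ C.influential R := by
  classical
  intro i hi
  unfold influential at hi ⊢
  rw [mem_filter] at hi ⊢
  refine ⟨mem_univ _, hi.2.imp_left fun h => ?_⟩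
  have := C.fanout_rewireConst_add k₀ a₀ c (.var i) (fun b h => by cases h)
  omega

/-- **Eliminating a semantically degenerate gate of the acyclic part** (Li–Yang Case 0.3, second
half, combined with Rules 2/3): if a gate `k₀` outside the xor-part has a wire whose value is
the constant `c` on every solution, then under the hypotheses of the one-step claim the circuit
can be simplified: one gate fewer, `μ' ≤ μ - (1 - 2α_φ)`, fair, `f|_R`, with a packing (a gate
of the acyclic part never reads itself, `arg_ne_self_of_not_mem`). [cite: LiYang2022, §4.1 (Case 0.3)] -/
theorem eliminate_semantic_const_wire {f : (Fin n → ZMod 2) → Bool} {R : RdqSource n} {d : ℕ}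
    (hf : IsAffineDisperser f d) (hd : 2 * d + 2 ≤ R.dim) (hF : C.Fair) (hC : C.ComputesRestr f R)
    (hk₀ : k₀ ∉ C.xorPart)
    {P : Finset (Fin C.m × Fin C.m)} (hP : C.IsPacking P)
    (hc : ∀ (x : Fin n → Bool) (w : Fin C.m → Bool), C.Consistent x w → C.nodeVal x w (C.arg k₀ a₀) = c)
    {αφ αI : ℝ} (hφ : 0 ≤ αφ) (hI : 0 ≤ αI) (αQ : ℝ) :
    ∃ (C' : Semicircuit n) (P' : Finset (Fin C'.m × Fin C'.m)), C'.Fair ∧ C'.ComputesRestr f R ∧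
      C'.IsPacking P' ∧ C'.m + 1 = C.m ∧
      C'.measure αφ αI αQ P' R ≤ C.measure αφ αI αQ P R - (1 - 2 * αφ) := by
  set C₁ := C.rewireConst k₀ a₀ c with hC₁
  have hF₁ : C₁.Fair := hF.rewireConst hk₀ c
  have hC₁' : C₁.ComputesRestr f R := hC.rewireConst hF hk₀ hc
  obtain ⟨P₁, hP₁, hpot⟩ := C.exists_packing_rewireConst k₀ a₀ c hP
  have h₀ : C₁.arg k₀ a₀ = .const c := by rw [rewireConst_arg, if_pos ⟨rfl, rfl⟩]
  have hself₁ : ∀ a, C₁.arg k₀ a ≠ .gate k₀ := by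
    intro a
    rw [rewireConst_arg]
    split_ifs
    · exact fun h => by cases h
    · exact C.arg_ne_self_of_not_mem hk₀ a
  obtain ⟨C', P', hF', hC', hP', hm, hμ⟩ :=
    rule23_any (C := C₁) hf hd hF₁ hC₁' hP₁ h₀ hself₁ hφ hI αQ
  refine ⟨C', P', hF', hC', hP', hm, ?_⟩
  -- `μ(C₁, P₁) ≤ μ(C, P) + αφ`
  have hinf : ((C₁.influential R).card : ℝ) ≤ (C.influential R).card := by
    exact_mod_cast card_le_card (C.influential_rewireConst_subset k₀ a₀ c R)
  have hμ₁ : C₁.measure αφ αI αQ P₁ R ≤ C.measure αφ αI αQ P R + αφ := by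
    unfold measure
    show (C.m : ℝ) + _ + _ + _ ≤ _
    nlinarith [mul_le_mul_of_nonneg_left hinf hI, mul_le_mul_of_nonneg_left hpot hφ]
  linarith

end RewireConstRule
end Semicircuit

end Literature.Computability.Complexity
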